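import Summits.QuantumFields.YangMills.Theorems.BalabanUVNodesN19JointLawPriceDimension
import Summits.QuantumFields.YangMills.Theorems.BalabanUVNodesN19JointLawSharpRate

/-!
# YM-DAG node N19 (= NE7 proper) — THE JOINT-LAW RATES IN CLOSED FORM AT THE SCHEME: `d` strings converge jointly at
# `(76K d² + 12G d)∕(1 + log R_K⁻¹)` on ℓ¹-Lipschitz functionals and at `48 d (K+G)∕(1 + log R_K⁻¹)` on additive ones

Cell `pub-ymgap`, HUMAN RULING D-0062 (Track A) ∕ D-0149 (work-bound push), R141 (C) wider-strategy seat `pub-ymgap-dag-n19-e` (strategy s3 =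
ALTERNATIVE CURRENCY), generation g21, module 4 (lineage module 67).  Route `Summits/QuantumFields/YangMills/Theses/BalabanUVNodes.lean` rev 25,
cluster item K3⁷ «SpineGivenEndpointR13SepCoPH» (stmt-QuantumFields-20544); filed `--supports` that item `--as helper` (it proves no registered
stub).  COUNT-NEUTRAL: bookkeeping over module 65 `…N19JointLawPriceDimension` (`law_price_le_of_uniformMixedMoments`, `law_price_additive_le_card`)
and p570436 `…N19JointLawRate` (`abs_mixedMoment_sub_integral_le_of_uniformTarget` — every mixed moment of a finite family of strings is within ONE
rate `R_K` of its continuum value under uniform `Target`) BY NAME; `Spine.NE7.Target` (N19's DECL-target SHAPE, NOT PRINTED, NOT proved) and the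
continuum joint law are HYPOTHESES; no Theses import; NOT a discharge claim.

WHY THIS FILE.  Module 62's header states the optimised orders of its `m`-parametrised rates (`≍ |ι|²∕log R_K⁻¹` jointly, `1∕K` for one string)
only in PROSE (referee ref-K READ #186, A4: «prose consequences NOT stated in Lean»); module 62 §3 typed the ONE-string closed form.  This file types
the `|ι|`-string closed forms, by instantiating module 65's law-level closed forms at `r = R_K`:
  `R_K = (4e^{1+l₀}∕l₀)·τ_K·(1 + log⁺ τ_K⁻¹)`, `τ_K = Σ_j 2·vol·δ_{K+j}` (p482030's lin-log tail, string-independent).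
★★ `abs_integral_sub_jointLaw_le_closedForm_of_uniformTarget`: under `∀ os, Spine.NE7.Target vol l₀ δ (schemeZ S os)` (`0 < l₀`), for a finite nonempty
family `os : ι → List O` (`d = |ι|`) with continuum joint law `ν` on `[−1,1]^ι` and every continuous `f` with `|f u − f v| ≤ K_f Σ_i|u_i − v_i|`,
`|f| ≤ G_f` on the cube, at every step `K` with `0 < R_K ≤ 1`:
  `|∫ f((∏os_i)_i) dgibbs_K − ∫ f dν| ≤ (76·K_f·d² + 12·G_f·d)∕(1 + log R_K⁻¹)`;
★★ `abs_integral_additive_sub_jointLaw_le_of_uniformTarget`: for ADDITIVE functionals `Σ_i g_i(∏os_i)` (`g_i` `K`-Lipschitz, `G`-bounded on `[−1,1]`):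
  `|∫ Σ_i g_i(∏os_i) dgibbs_K − ∫ Σ_i g_i(x_i) dν| ≤ 48·d·(K + G)∕(1 + log R_K⁻¹)`
— LINEAR in the number of strings (and by module 66 not improvable in `d` on this class at the law level), QUADRATIC for general ℓ¹-Lipschitz
functionals (module 66: at least linear).  For geometric remainders `log R_K⁻¹ ≍ K`: `d²∕K` resp. `d∕K`.

HONEST FRAMING (binding).  Bookkeeping; `ν` is a typed RESTATEMENT DEVICE for the string-indexed limits (dag-lead guard); NO consumer in the DAG today;
`Target` HYPOTHESIS; constants not optimised; nothing of Bałaban's instantiated; NE7 NOT PRINTED, NOT proved; N19 NOT discharged; count-neutral.  One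
finite `T⁴` programme at fixed `ε` → 0 at FIXED volume; NOT a continuum ∕ `ℝ⁴` ∕ infinite-volume ∕ OS ∕ mass-gap ∕ Clay statement.  0 `def` ∕ 0 `sorry`.
-/

noncomputable section

open Real Finset Filter Topology MeasureTheory ProbabilityTheory

namespace Summit.QuantumFields.YangMills.Theorems.BalabanUVNodesN19JointLawClosedFormAtScheme

open Literature.MathematicalPhysics.QuantumFieldTheory.Balaban1983to89
open T4GenFunBounds (prodObs gibbsMeasure schemeZ)
open Missing (TorusScheme)
open Summit.QuantumFields.BalabanUV.T4Continuum.Spine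
open Summit.QuantumFields.YangMills.BalabanUVNodes.N19ExpectationCurrencyAtScheme (mul_nonneg_of_matchingModConstants)
open Summit.QuantumFields.YangMills.Theorems.BalabanUVNodesN19JointLawRate (abs_mixedMoment_sub_integral_le_of_uniformTarget)
open Summit.QuantumFields.YangMills.Theorems.BalabanUVNodesN19JointLawPriceDimension
  (law_price_le_of_uniformMixedMoments law_price_additive_le_card)

variable {G : Type*} [GaugeGroup G] [MeasurableSpace G] [RegularGaugeGroup G] [HaarData G] {O : Type*}
  (S : TorusScheme G O) (hβ : ∀ K, 0 ≤ S.β K) (hm : ∀ K o, Measurable (S.obs K o)) (h1 : ∀ K o U, |S.obs K o U| ≤ 1)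
include hβ hm h1

/-- The step-`K` joint law of a finite family of strings, pushed to `ℝ^ι`: a probability law carried by the cube whose integrals of continuous
functionals are the Gibbs integrals, and whose mixed moments are `R_K`-close to those of the continuum joint law (p570436 BY NAME). [bookkeeping] -/
theorem jointLaw_pushforward {ι : Type*} [Fintype ι] {vol l₀ : ℝ} {δ : ℕ → ℝ}
    (hl₀ : 0 < l₀) (hT : ∀ os : List O, NE7.Target vol l₀ δ (schemeZ S os)) (os : ι → List O) (ν : Measure (ι → ℝ))
    (hν : ∀ f : (ι → ℝ) → ℝ, Continuous f →
      Tendsto (fun K => ∫ U, f (fun i => prodObs S K (os i) U) ∂gibbsMeasure (S.P K) (S.β K)) atTop (𝓝 (∫ x, f x ∂ν))) (K : ℕ) :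
    ∃ P : Measure (ι → ℝ), IsProbabilityMeasure P ∧ P (Set.pi Set.univ (fun _ : ι => Set.Icc (-1 : ℝ) 1))ᶜ = 0 ∧
      (∀ {h : (ι → ℝ) → ℝ}, Continuous h → ∫ x, h x ∂P = ∫ U, h (fun i => prodObs S K (os i) U) ∂gibbsMeasure (S.P K) (S.β K)) ∧
      (0 ≤ 4 * Real.exp (1 + l₀) / l₀ * (∑' j, 2 * (vol * δ (K + j))) * (1 + Real.posLog (∑' j, 2 * (vol * δ (K + j)))⁻¹)) ∧
      ∀ j : ι → ℕ, |∫ x, ∏ i, x i ^ j i ∂P - ∫ x, ∏ i, x i ^ j i ∂ν| ≤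
        4 * Real.exp (1 + l₀) / l₀ * (∑' j, 2 * (vol * δ (K + j))) * (1 + Real.posLog (∑' j, 2 * (vol * δ (K + j)))⁻¹) := by
  haveI hP : IsProbabilityMeasure (gibbsMeasure (G := G) (S.P K) (S.β K)) := T4GenFunBounds.isProbabilityMeasure_gibbsMeasure (G := G) (S.P K) (hβ K)
  have hvec : Measurable fun U : GaugeField (S.P K) 0 G => fun i => prodObs S K (os i) U :=
    measurable_pi_lambda _ fun i => T4GenFunBounds.measurable_prodObs S hm K (os i)
  set P : Measure (ι → ℝ) := (gibbsMeasure (S.P K) (S.β K)).map fun U => fun i => prodObs S K (os i) U with hPdef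
  haveI : IsProbabilityMeasure P := Measure.isProbabilityMeasure_map hvec.aemeasurable
  have hPc : P (Set.pi Set.univ (fun _ : ι => Set.Icc (-1 : ℝ) 1))ᶜ = 0 := by
    rw [hPdef, Measure.map_apply hvec (MeasurableSet.univ_pi fun _ => measurableSet_Icc).compl]
    have he : (fun U : GaugeField (S.P K) 0 G => fun i => prodObs S K (os i) U) ⁻¹' (Set.pi Set.univ (fun _ : ι => Set.Icc (-1 : ℝ) 1))ᶜ = ∅ := by
      ext U
      simp only [Set.mem_preimage, Set.mem_compl_iff, Set.mem_empty_iff_false, iff_false, not_not, Set.mem_univ_pi]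
      exact fun i => abs_le.1 (T4GenFunBounds.abs_prodObs_le_one S h1 K (os i) _)
    rw [he, measure_empty]
  have hint : ∀ {h : (ι → ℝ) → ℝ}, Continuous h → ∫ x, h x ∂P = ∫ U, h (fun i => prodObs S K (os i) U) ∂gibbsMeasure (S.P K) (S.β K) :=
    fun hh => integral_map hvec.aemeasurable hh.aestronglyMeasurable
  have hτ0 : 0 ≤ ∑' j, 2 * (vol * δ (K + j)) := tsum_nonneg fun j => mul_nonneg two_pos.le
    (mul_nonneg_of_matchingModConstants hl₀.le (hT []).1 (K + j))
  have hR0 : 0 ≤ 4 * Real.exp (1 + l₀) / l₀ * (∑' j, 2 * (vol * δ (K + j))) * (1 + Real.posLog (∑' j, 2 * (vol * δ (K + j)))⁻¹) :=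
    mul_nonneg (mul_nonneg (div_nonneg (mul_nonneg (by norm_num) (Real.exp_pos _).le) hl₀.le) hτ0)
      (add_nonneg zero_le_one Real.posLog_nonneg)
  refine ⟨P, inferInstance, hPc, hint, hR0, fun j => ?_⟩
  rw [hint (h := fun x : ι → ℝ => ∏ i, x i ^ j i) (continuous_finsetProd _ fun i _ => (continuous_apply i).pow _)]
  exact abs_mixedMoment_sub_integral_le_of_uniformTarget S hβ hm h1 hl₀ hT os ν hν j K

/-- ★★ **THE JOINT LAW OF `d` STRINGS IN CLOSED FORM: `(76K d² + 12G d)∕(1 + log R_K⁻¹)`.**  Under `Spine.NE7.Target vol l₀ δ (schemeZ S os)` for EVERY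
string (`0 < l₀`), for a finite nonempty family `os : ι → List O` (`d = |ι|`) with a continuum joint law `ν` on `[−1,1]^ι` receiving all continuous
functionals, every continuous `f` with `|f u − f v| ≤ K_f Σ_i|u_i − v_i|`, `|f| ≤ G_f` on the cube, and every step `K` at which
`R_K = (4e^{1+l₀}∕l₀)·τ_K·(1 + log⁺τ_K⁻¹) ∈ (0, 1]`:
`|∫ f((∏os_i)_i) dgibbs_K − ∫ f dν| ≤ (76·K_f·d² + 12·G_f·d)∕(1 + log R_K⁻¹)` (module 65 at `r = R_K`; module 62's prose order as a theorem).
Quadratic in `d`; `≍ d²∕K` for geometric remainders. [bookkeeping] -/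
theorem abs_integral_sub_jointLaw_le_closedForm_of_uniformTarget {ι : Type*} [Fintype ι] [Nonempty ι] {vol l₀ : ℝ} {δ : ℕ → ℝ}
    (hl₀ : 0 < l₀) (hT : ∀ os : List O, NE7.Target vol l₀ δ (schemeZ S os)) (os : ι → List O) (ν : Measure (ι → ℝ)) [IsProbabilityMeasure ν]
    (hν1 : ν (Set.pi Set.univ (fun _ : ι => Set.Icc (-1 : ℝ) 1))ᶜ = 0)
    (hν : ∀ f : (ι → ℝ) → ℝ, Continuous f →
      Tendsto (fun K => ∫ U, f (fun i => prodObs S K (os i) U) ∂gibbsMeasure (S.P K) (S.β K)) atTop (𝓝 (∫ x, f x ∂ν)))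
    {f : (ι → ℝ) → ℝ} (hf : Continuous f) {Kf Gf : ℝ} (hK0 : 0 ≤ Kf)
    (hK : ∀ u v : ι → ℝ, (∀ i, u i ∈ Set.Icc (-1 : ℝ) 1) → (∀ i, v i ∈ Set.Icc (-1 : ℝ) 1) → |f u - f v| ≤ Kf * ∑ i, |u i - v i|)
    (hG : ∀ u : ι → ℝ, (∀ i, u i ∈ Set.Icc (-1 : ℝ) 1) → |f u| ≤ Gf) (K : ℕ)
    (hR0 : 0 < 4 * Real.exp (1 + l₀) / l₀ * (∑' j, 2 * (vol * δ (K + j))) * (1 + Real.posLog (∑' j, 2 * (vol * δ (K + j)))⁻¹))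
    (hR1 : 4 * Real.exp (1 + l₀) / l₀ * (∑' j, 2 * (vol * δ (K + j))) * (1 + Real.posLog (∑' j, 2 * (vol * δ (K + j)))⁻¹) ≤ 1) :
    |∫ U, f (fun i => prodObs S K (os i) U) ∂gibbsMeasure (S.P K) (S.β K) - ∫ x, f x ∂ν| ≤
      (76 * Kf * (Fintype.card ι : ℝ) ^ 2 + 12 * Gf * Fintype.card ι) /
        (1 + Real.log (4 * Real.exp (1 + l₀) / l₀ * (∑' j, 2 * (vol * δ (K + j))) * (1 + Real.posLog (∑' j, 2 * (vol * δ (K + j)))⁻¹))⁻¹) := by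
  obtain ⟨P, iP, hPc, hint, -, hmom⟩ := jointLaw_pushforward S hβ hm h1 hl₀ hT os ν hν K
  rw [← hint hf]
  exact law_price_le_of_uniformMixedMoments hPc hν1 hR0 hR1 hmom hf hK0 hK hG

/-- ★★ **ADDITIVE FUNCTIONALS OF `d` STRINGS: `48·d·(K+G)∕(1 + log R_K⁻¹)`.**  Same hypotheses; for `g_i : ℝ → ℝ` continuous, `K`-Lipschitz and
`G`-bounded on `[−1,1]`, the sum of one-string observables `Σ_i g_i(∏os_i)` satisfies
`|∫ Σ_i g_i(∏os_i) dgibbs_K − ∫ Σ_i g_i(x_i) dν| ≤ 48·d·(K + G)∕(1 + log R_K⁻¹)` — LINEAR in the number of strings (module 65's additive price at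
`r = R_K`; for one string this is module 62 §3's `48(K+G)∕(1 + log R_K⁻¹)` summed, but stated against the JOINT law `ν`).  By module 66 the linear
growth is sharp on this class at the law level. [bookkeeping] -/
theorem abs_integral_additive_sub_jointLaw_le_of_uniformTarget {ι : Type*} [Fintype ι] {vol l₀ : ℝ} {δ : ℕ → ℝ}
    (hl₀ : 0 < l₀) (hT : ∀ os : List O, NE7.Target vol l₀ δ (schemeZ S os)) (os : ι → List O) (ν : Measure (ι → ℝ)) [IsProbabilityMeasure ν]
    (hν1 : ν (Set.pi Set.univ (fun _ : ι => Set.Icc (-1 : ℝ) 1))ᶜ = 0)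
    (hν : ∀ f : (ι → ℝ) → ℝ, Continuous f →
      Tendsto (fun K => ∫ U, f (fun i => prodObs S K (os i) U) ∂gibbsMeasure (S.P K) (S.β K)) atTop (𝓝 (∫ x, f x ∂ν)))
    {g : ι → ℝ → ℝ} (hg : ∀ i, Continuous (g i)) {Kg Gg : ℝ} (hK0 : 0 ≤ Kg)
    (hK : ∀ (i : ι) (x y : ℝ), x ∈ Set.Icc (-1 : ℝ) 1 → y ∈ Set.Icc (-1 : ℝ) 1 → |g i x - g i y| ≤ Kg * |x - y|)
    (hG : ∀ (i : ι) (x : ℝ), x ∈ Set.Icc (-1 : ℝ) 1 → |g i x| ≤ Gg) (K : ℕ)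
    (hR0 : 0 < 4 * Real.exp (1 + l₀) / l₀ * (∑' j, 2 * (vol * δ (K + j))) * (1 + Real.posLog (∑' j, 2 * (vol * δ (K + j)))⁻¹))
    (hR1 : 4 * Real.exp (1 + l₀) / l₀ * (∑' j, 2 * (vol * δ (K + j))) * (1 + Real.posLog (∑' j, 2 * (vol * δ (K + j)))⁻¹) ≤ 1) :
    |∫ U, ∑ i, g i (prodObs S K (os i) U) ∂gibbsMeasure (S.P K) (S.β K) - ∫ x, ∑ i, g i (x i) ∂ν| ≤
      48 * Fintype.card ι * (Kg + Gg) /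
        (1 + Real.log (4 * Real.exp (1 + l₀) / l₀ * (∑' j, 2 * (vol * δ (K + j))) * (1 + Real.posLog (∑' j, 2 * (vol * δ (K + j)))⁻¹))⁻¹) := by
  obtain ⟨P, iP, hPc, hint, -, hmom⟩ := jointLaw_pushforward S hβ hm h1 hl₀ hT os ν hν K
  have hc : Continuous fun x : ι → ℝ => ∑ i, g i (x i) := continuous_finsetSum _ fun i _ => (hg i).comp (continuous_apply i)
  rw [← hint hc]
  exact law_price_additive_le_card hPc hν1 hR0 hR1 hmom hg hK0 hK hG

end Summit.QuantumFields.YangMills.Theorems.BalabanUVNodesN19JointLawClosedFormAtScheme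

end
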